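import Literature.MathematicalPhysics.QuantumFieldTheory.SchwartzTensorNorms
import Literature.Analysis.FunctionSpaces.SchwartzCompEquivBound
import Literature.Analysis.Matrix.DifferencesEquiv
import HarnessLib

/-!
# The regularisation weight on point times (OS II, Ch. VI.1)

Topic `Literature/MathematicalPhysics/QuantumFieldTheory`. In the Ch. VI.1 estimates of
Osterwalder–Schrader II (Comm. Math. Phys. 42 (1975)) the superposed, time-averaged left cluster of a
slot is an average of skeleton clusters over their point times `a ∈ ℝ^{m+1}` with the weight

  `hW(a) = ρ'(a_m) ∏_{J<m} W_J(a_{J+1} - a_J)`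

(`ρ'` the profile of the time average of the anchor point, `W_J` the profiles of the consecutive
gaps). This file realises `hW` as a **Schwartz function of the point times** —
`regWeight W ρ' = (⊗ (W₀, …, W_{m-1}, ρ')) ∘ diffEquiv` (`regWeight_apply`) — and bounds its
Schwartz norms by those of the factors (`schwartzNorm_regWeight_le`:
`|hW|_M ≤ K_m^M (2^{M+1})^{m+1} |ρ'|_M ∏ |W_J|_M`, `K_m = max(1, ‖D⁻¹‖) max(1, ‖D‖)`), so that bounds on
the one-variable profiles that are uniform in the regularisation pass to the weight (the input of
`OSAveragedClusters`).

## References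

* K. Osterwalder, R. Schrader, *Axioms for Euclidean Green's functions II*, Comm. Math. Phys.
  42 (1975) 281–305, Ch. VI.1. [OsterwalderSchraderCMP1975]
-/

noncomputable section

open scoped SchwartzMap

namespace Literature.MathematicalPhysics.QuantumFieldTheory

open Literature.MathematicalPhysics.QuantumLattice (schwartzNorm)
open Literature.Analysis.Matrix

variable {m : ℕ}

/-- The one-variable factors in (gaps, anchor) order: `W₀, …, W_{m-1}, ρ'`. [folklore] -/
def regFactors (W : Fin m → 𝓢(ℝ, ℂ)) (ρ' : 𝓢(ℝ, ℂ)) : Fin (m + 1) → 𝓢(ℝ, ℂ) := Fin.snoc W ρ'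

/-- **The regularisation weight** `hW = (⊗ regFactors) ∘ diffEquiv` on the point times `ℝ^{m+1}`. [cite: OsterwalderSchraderCMP1975, Ch. VI.1] -/
def regWeight (W : Fin m → 𝓢(ℝ, ℂ)) (ρ' : 𝓢(ℝ, ℂ)) : 𝓢((Fin (m + 1) → ℝ), ℂ) :=
  SchwartzMap.compCLMOfContinuousLinearEquiv ℂ (diffEquiv m) (SchwartzMap.tensorFin (m + 1) (regFactors W ρ'))

/-- **Values of the regularisation weight**: `hW(a) = ρ'(a_m) ∏_J W_J(a_{J+1} - a_J)`. [folklore] -/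
theorem regWeight_apply (W : Fin m → 𝓢(ℝ, ℂ)) (ρ' : 𝓢(ℝ, ℂ)) (a : Fin (m + 1) → ℝ) :
    regWeight W ρ' a = ρ' (a (Fin.last m)) * ∏ J : Fin m, W J (a J.succ - a J.castSucc) := by
  simp only [regWeight, regFactors]
  rw [show (SchwartzMap.compCLMOfContinuousLinearEquiv ℂ (diffEquiv m)
      (SchwartzMap.tensorFin (m + 1) (Fin.snoc W ρ'))) a =
      SchwartzMap.tensorFin (m + 1) (Fin.snoc W ρ') (diffEquiv m a) by simp]
  rw [SchwartzMap.tensorFin_apply, Fin.prod_univ_castSucc]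
  simp only [Fin.snoc_last, Fin.snoc_castSucc, diffEquiv_apply_last, diffEquiv_apply_castSucc]
  ring

/-- **Values at an anchored configuration**: `hW(gapAnchor (t, g)) = ρ'(t) ∏_J W_J(g_J)`. [folklore] -/
theorem regWeight_gapAnchor (W : Fin m → 𝓢(ℝ, ℂ)) (ρ' : 𝓢(ℝ, ℂ)) (z : ℝ × (Fin m → ℝ)) :
    regWeight W ρ' (gapAnchor m z) = ρ' z.1 * ∏ J : Fin m, W J (z.2 J) := by
  simp only [regWeight, regFactors]
  rw [show (SchwartzMap.compCLMOfContinuousLinearEquiv ℂ (diffEquiv m)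
      (SchwartzMap.tensorFin (m + 1) (Fin.snoc W ρ'))) (gapAnchor m z) =
      SchwartzMap.tensorFin (m + 1) (Fin.snoc W ρ') (diffEquiv m (gapAnchor m z)) by simp]
  rw [diffEquiv_gapAnchor, SchwartzMap.tensorFin_apply, Fin.prod_univ_castSucc]
  simp only [Fin.snoc_last, Fin.snoc_castSucc]
  ring

/-- The constant of the coordinate change: `K_m = max(1, ‖D⁻¹‖) · max(1, ‖D‖)`. [folklore] -/
def diffConst (m : ℕ) : ℝ :=
  max 1 ‖((diffEquiv m).symm : (Fin (m + 1) → ℝ) →L[ℝ] (Fin (m + 1) → ℝ))‖ *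
    max 1 ‖((diffEquiv m) : (Fin (m + 1) → ℝ) →L[ℝ] (Fin (m + 1) → ℝ))‖

/-- `1 ≤ K_m`. [folklore] -/
theorem one_le_diffConst (m : ℕ) : 1 ≤ diffConst m :=
  one_le_mul_of_one_le_of_one_le (le_max_left _ _) (le_max_left _ _)

/-- **Schwartz norms of the regularisation weight through its factors**:
`|hW|_M ≤ K_m^{2M} (2^{M+1})^{m+1} |ρ'|_M ∏_J |W_J|_M`. [folklore] -/
theorem schwartzNorm_regWeight_le (W : Fin m → 𝓢(ℝ, ℂ)) (ρ' : 𝓢(ℝ, ℂ)) (M : ℕ) :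
    schwartzNorm M (regWeight W ρ') ≤
      diffConst m ^ (M + M) * (2 ^ (M + 1)) ^ (m + 1) * (schwartzNorm M ρ' * ∏ J : Fin m, schwartzNorm M (W J)) := by
  have hK1 := one_le_diffConst m
  have hfac : ∀ J, 0 ≤ schwartzNorm M (regFactors W ρ' J) := fun J => QuantumLattice.schwartzNorm_nonneg _ _
  have hprod : ∏ J : Fin (m + 1), schwartzNorm M (regFactors W ρ' J) = schwartzNorm M ρ' * ∏ J : Fin m, schwartzNorm M (W J) := by
    rw [Fin.prod_univ_castSucc]
    simp only [regFactors, Fin.snoc_last, Fin.snoc_castSucc]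
    ring
  have htens : schwartzNorm M (SchwartzMap.tensorFin (m + 1) (regFactors W ρ')) ≤
      (2 ^ (M + 1)) ^ (m + 1) * (schwartzNorm M ρ' * ∏ J : Fin m, schwartzNorm M (W J)) := by
    rw [← hprod]; exact schwartzNorm_tensorFin_le _ M
  have hT0 : 0 ≤ schwartzNorm M (SchwartzMap.tensorFin (m + 1) (regFactors W ρ')) := QuantumLattice.schwartzNorm_nonneg _ _
  unfold regWeight QuantumLattice.schwartzNorm
  refine Seminorm.finset_sup_apply_le (by positivity) fun q hq => ?_
  rw [Finset.mem_Iic] at hq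
  rw [SchwartzMap.schwartzSeminormFamily_apply]
  have hq1 : q.1 ≤ M := hq.1
  have hq2 : q.2 ≤ M := hq.2
  have h1 := Literature.Analysis.FunctionSpaces.seminorm_compCLMOfContinuousLinearEquiv_le (diffEquiv m)
    (SchwartzMap.tensorFin (m + 1) (regFactors W ρ')) q.1 q.2
  have h2 : SchwartzMap.seminorm ℝ q.1 q.2 (SchwartzMap.tensorFin (m + 1) (regFactors W ρ')) ≤
      schwartzNorm M (SchwartzMap.tensorFin (m + 1) (regFactors W ρ')) :=
    QuantumLattice.seminorm_le_schwartzNorm (m := M) hq1 hq2 _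
  have hnorm1 : ‖((diffEquiv m).symm : (Fin (m + 1) → ℝ) →L[ℝ] (Fin (m + 1) → ℝ))‖ ^ q.1 ≤ diffConst m ^ M := by
    calc ‖((diffEquiv m).symm : (Fin (m + 1) → ℝ) →L[ℝ] (Fin (m + 1) → ℝ))‖ ^ q.1
        ≤ (max 1 ‖((diffEquiv m).symm : (Fin (m + 1) → ℝ) →L[ℝ] (Fin (m + 1) → ℝ))‖) ^ q.1 :=
          pow_le_pow_left₀ (norm_nonneg _) (le_max_right _ _) _
      _ ≤ (diffConst m) ^ q.1 := pow_le_pow_left₀ (by positivity)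
          (le_mul_of_one_le_right (by positivity) (le_max_left _ _)) _
      _ ≤ (diffConst m) ^ M := pow_le_pow_right₀ hK1 hq1
  have hnorm2 : ‖((diffEquiv m) : (Fin (m + 1) → ℝ) →L[ℝ] (Fin (m + 1) → ℝ))‖ ^ q.2 ≤ diffConst m ^ M := by
    calc ‖((diffEquiv m) : (Fin (m + 1) → ℝ) →L[ℝ] (Fin (m + 1) → ℝ))‖ ^ q.2
        ≤ (max 1 ‖((diffEquiv m) : (Fin (m + 1) → ℝ) →L[ℝ] (Fin (m + 1) → ℝ))‖) ^ q.2 :=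
          pow_le_pow_left₀ (norm_nonneg _) (le_max_right _ _) _
      _ ≤ (diffConst m) ^ q.2 := pow_le_pow_left₀ (by positivity)
          (le_mul_of_one_le_left (by positivity) (le_max_left _ _)) _
      _ ≤ (diffConst m) ^ M := pow_le_pow_right₀ hK1 hq2
  calc SchwartzMap.seminorm ℂ q.1 q.2 (SchwartzMap.compCLMOfContinuousLinearEquiv ℂ (diffEquiv m)
        (SchwartzMap.tensorFin (m + 1) (regFactors W ρ')))
      ≤ ‖((diffEquiv m).symm : (Fin (m + 1) → ℝ) →L[ℝ] (Fin (m + 1) → ℝ))‖ ^ q.1 *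
          ‖((diffEquiv m) : (Fin (m + 1) → ℝ) →L[ℝ] (Fin (m + 1) → ℝ))‖ ^ q.2 *
          SchwartzMap.seminorm ℝ q.1 q.2 (SchwartzMap.tensorFin (m + 1) (regFactors W ρ')) := h1
    _ ≤ diffConst m ^ M * diffConst m ^ M *
          ((2 ^ (M + 1)) ^ (m + 1) * (schwartzNorm M ρ' * ∏ J : Fin m, schwartzNorm M (W J))) := by
        gcongr
        · exact h2.trans htens
    _ = diffConst m ^ (M + M) * (2 ^ (M + 1)) ^ (m + 1) * (schwartzNorm M ρ' * ∏ J : Fin m, schwartzNorm M (W J)) := by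
        rw [pow_add]; ring

end Literature.MathematicalPhysics.QuantumFieldTheory
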